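import Summits.BirchSwinnertonDyer.BirchSwinnertonDyer.Theorems.SmallImageMuTransferMuTransferSplit
import Summits.BirchSwinnertonDyer.BirchSwinnertonDyer.Theorems.SmallImageMuTransferMuTransferX9CoreClosed
import Literature.NumberTheory.GaloisCohomology.PoitouTateNumberField
import Summits.BirchSwinnertonDyer.BirchSwinnertonDyer.Theorems.SmallImageMuTransferMuTransferX9StubRed
import HarnessLib

/-!
# Parent crux `MuTransfer` of route `SmallImageMuTransfer` (stmt-BirchSwinnertonDyer-19629) BY NAME,
# modulo exactly its remaining NAMED FACTS: F1, F2 and the six published inputs of `MuTransferInputs`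

Cell `bsd-smallim`, seat `bsd-smallim-k6-c2` (gen 5, lead of the line `MuTransfer → MuTransferX9`).
BOOKKEEPING ONLY — this file composes LANDED theorems and credits no new mathematics; it exists so that the
ledger carries, on the parent item 19629 itself, one theorem whose conclusion is the route decl
`Theses.SmallImageMuTransfer.MuTransfer` (`:= Rank1Residual.KatoMuTransfer`: for `E/ℚ` on a global minimal
model, `p ≥ 5` good ordinary with `E[p]` irreducible — surjective OR not —, `f` a newform of `E`, one `p`-adic
unit coefficient of `L_p(f, α, T)` forces `μ(X(E/ℚ_∞)) = 0` for every cyclotomic Selmer-dual datum) and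
whose hypotheses are exactly the named facts still unproved in the tree (the seat row's «19629 closes modulo
named facts via `--supports stmt-BirchSwinnertonDyer-19629`», D-0074 group (F)).  HONEST FRAMING: proves no
case of BSD and closes no item (19629 is unconditional and stays OPEN; it closes through the CLOSED glue
`MuTransferSplit` (19278, p-MuTransferSplit) the day its two children are theorems); the gate records a
`conditional-result`.

Hypotheses, all `def … : Prop` named facts of the tree (never inlined, never asserted):
* F1 `Kato2004.exists_divisibilityInputs_fineQuotient_zeta` — Kato 2004 Thm. 12.5/12.6 zeta-element
  package with the fine quotient (14.9.3)/(17.13.1) and the Thm. 12.6 span clause (item 19843; published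
  input, no in-tree proof expected);
* F2 `Kato2004.mem_pSmul_of_red_eq_zero` — Kato §13.8, `ker (red : 𝐇¹ → ∏ H¹(ℚ_n, E[p])) ⊆ p𝐇¹` (item
  19844; in-tree discharge in flight, seats k6-g4/k6-g3/lur-a: König roots p475393/p477776 + Lemma 8.5 (2));
* the six conjuncts of `MuTransferInputs` (item 19277, cite-only): Kato 2004 Thm. 17.4 `kato_divisibility`,
  Burungale–Castella–Skinner 2025 (a), Rubin 1991 Thm. 12.3, Greenberg–Vatsal 2000 Thm. 1.4, the period
  relation A25 `realPeriodRat_eq_unit_mul_plusPeriod`, Carayol `IsNewformOf.level_eq_conductorNorm`.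
NOT a hypothesis any more: F3 = Poitou–Tate over `ℚ`, `GaloisCohomology.poitouTate_sum_localTatePairing_eq_zero
ℚ`, a TREE THEOREM since p475389 (`poitouTate_sum_localTatePairing_eq_zero_holds`, cell bsd-cn100, Tate CF VII
§11 / Milne ADT I 4.10 (b)); nor Tate's local Euler–Poincaré characteristic nor the registered stubs of the
line (`stub_selmerDualOdd`, `stub_stepsTwoFourOdd` — theorems p465845 / p474398), all inside the closed core
`Theorems.smallImageMuTransfer_MuTransferX9Core_proof` (item 19842, p476037).

Proof = `smallImageMuTransfer_MuTransferSplit_proof` (glue: excluded middle on surjectivity, then on CM;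
Kato 17.4 (3) + BCS (a) helper p415185, Rubin + GV helper p417975) applied to
`smallImageMuTransfer_MuTransferX9Core_proof hfineZ hred (poitouTate_…_holds ℚ)` and the inputs tuple.
PARTITION (D-0054): X9 (A4; good-ordinary `p ∈ {5,7}`, `ρ̄` irreducible ∧ ¬surjective; book230 0 open cells,
class-wide 790 pairs) — types-the-object-of A4; closes NONE; bears_on: K6
(route-BirchSwinnertonDyer-SmallImageMuTransfer item 19629).  Registered skeleton of the child crux 19276:
v8 (sha16 9f511c687a7e7de3, this seat; stubs `stub_inputsX9 : F1`, `stub_red : F2`).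

References: K. Kato, Astérisque 295 (2004) Thm. 12.5, 12.6, Ex. 13.3, §13.8, Thm. 17.4, §17.13
[Kato2004Asterisque]; A. Burungale, F. Castella, C. Skinner (2025) Thm. A (a) [BurungaleCastellaSkinner2025];
K. Rubin, Invent. Math. 103 (1991) Thm. 12.3 [Rubin1991]; R. Greenberg, V. Vatsal, Invent. Math. 142 (2000)
Thm. 1.4, Prop. 3.7 [GreenbergVatsal2000]; J. S. Milne, *Arithmetic Duality Theorems* (2006) I Thm. 4.10 (b)
[MilneADT2006]; HOME/koly/KOLY-MEMO.md v1.8 Thm. 5.7.1 / Cor. 5.7.2, MU-TRANSFER-PROOF.md Theorem A / Cor. B.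
-/

-- the summit and its single problem are both named `BirchSwinnertonDyer` (registry layout D-0017)
set_option linter.dupNamespace false
set_option autoImplicit false

namespace Summit.BirchSwinnertonDyer.BirchSwinnertonDyer.Theorems

open Literature.NumberTheory.EllipticCurves Literature.NumberTheory.EllipticCurves.ModularForms
  Literature.NumberTheory.EllipticCurves.Kato2004 Literature.NumberTheory.GaloisCohomology
  CongruenceSubgroup

/-- **The parent crux `MuTransfer` (stmt-BirchSwinnertonDyer-19629), literally the route decl, modulo its
remaining named facts** — F1 (Kato 2004 Thm. 12.5/12.6 zeta-element package), F2 (Kato §13.8 kernel of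
reduction mod `p` on `𝐇¹`) for the X9 case, and the six published inputs of `MuTransferInputs` (Kato 17.4,
BCS (a), Rubin 12.3, GV 1.4, A25, Carayol) for the surjective and CM cases; Poitou–Tate over `ℚ` is supplied
by the tree theorem `poitouTate_sum_localTatePairing_eq_zero_holds ℚ`.  Bookkeeping composition of the
closed glue 19278 and the closed core 19842; the item stays open until the hypotheses are theorems.
[cite: Kato2004Asterisque, Thm. 12.5, Thm. 12.6, §13.8, Thm. 17.4 (3), §17.13 (p. 280)] -/
theorem smallImageMuTransfer_MuTransfer_of_facts
    (hfineZ : exists_divisibilityInputs_fineQuotient_zeta)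
    (hred : mem_pSmul_of_red_eq_zero)
    (hKato : ∀ (W : WeierstrassCurve ℚ) [W.IsElliptic] [W.IsGloballyMinimal] (p : ℕ) [Fact p.Prime]
      (κ : ZpExtension ℚ p) (γ : Field.absoluteGaloisGroup ℚ) (N : ℕ) [NeZero N]
      (f : CuspForm (Gamma0 N) 2), kato_divisibility W p (κ := κ) (γ := γ) (f := f))
    (hBCS : burungale_castella_skinner_charIdeal_eq_padicLFunction)
    (hRu : Rubin1991.thm123_charIdeal_eq_padicLFunction_of_cm)
    (hGV : GreenbergVatsal2000.thm14_mainConjecture_transfer_of_torsionIso)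
    (h5 : realPeriodRat_eq_unit_mul_plusPeriod)
    (hlev : ∀ (N : ℕ) [NeZero N], IsNewformOf.level_eq_conductorNorm (N := N)) :
    Summit.BirchSwinnertonDyer.BirchSwinnertonDyer.Theses.SmallImageMuTransfer.MuTransfer :=
  smallImageMuTransfer_MuTransferSplit_proof
    (smallImageMuTransfer_MuTransferX9Core_proof hfineZ hred
      (poitouTate_sum_localTatePairing_eq_zero_holds ℚ))
    ⟨hKato, hBCS, hRu, hGV, h5, hlev⟩

/-- **The same statement under the tree's name `Rank1Residual.KatoMuTransfer`** (the head constant of item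
19629 and the hypothesis of the rung-K6 kernel bridge `bsdpOnClassX9_of_katoMuTransfer`, p407118):
`MuTransfer` unfolds to it by `δ`.
[cite: Kato2004Asterisque, Thm. 12.5, Thm. 12.6, §13.8, Thm. 17.4 (3), §17.13 (p. 280)] -/
theorem smallImageMuTransfer_katoMuTransfer_of_facts
    (hfineZ : exists_divisibilityInputs_fineQuotient_zeta)
    (hred : mem_pSmul_of_red_eq_zero)
    (hKato : ∀ (W : WeierstrassCurve ℚ) [W.IsElliptic] [W.IsGloballyMinimal] (p : ℕ) [Fact p.Prime]
      (κ : ZpExtension ℚ p) (γ : Field.absoluteGaloisGroup ℚ) (N : ℕ) [NeZero N]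
      (f : CuspForm (Gamma0 N) 2), kato_divisibility W p (κ := κ) (γ := γ) (f := f))
    (hBCS : burungale_castella_skinner_charIdeal_eq_padicLFunction)
    (hRu : Rubin1991.thm123_charIdeal_eq_padicLFunction_of_cm)
    (hGV : GreenbergVatsal2000.thm14_mainConjecture_transfer_of_torsionIso)
    (h5 : realPeriodRat_eq_unit_mul_plusPeriod)
    (hlev : ∀ (N : ℕ) [NeZero N], IsNewformOf.level_eq_conductorNorm (N := N)) :
    Summit.BirchSwinnertonDyer.BirchSwinnertonDyer.Rank1Residual.KatoMuTransfer :=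
  smallImageMuTransfer_MuTransfer_of_facts hfineZ hred hKato hBCS hRu hGV h5 hlev

/-- **The parent crux `MuTransfer` (19629), literally the route decl, modulo F1 and the six published inputs
of `MuTransferInputs` ONLY** — F2 (Kato §13.8) is now the tree theorem
`UniversalNorms.mem_pSmul_of_red_eq_zero_holds` (cell `bsd-smallim` lur-a g2, p480014: the weak Lemma 8.5 (2)
`UniversalNorms.mem_integralH1_of_layerCores_eq_of_smul_mem` through k6-g4 g2's König-roots reduction
`Kato2004.mem_pSmul_of_red_eq_zero_of_integral_of_smul_mem`), F3 (Poitou–Tate over `ℚ`) the tree theorem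
`poitouTate_sum_localTatePairing_eq_zero_holds ℚ` (cell `bsd-cn100`, p475389).  Pre-written by the line lead
k6-c2 g5 (BATON, cell bus l.396 (b)); filed by b2b-bsdres x10 g40.  Bookkeeping; the item stays open until the
hypotheses are theorems. [cite: Kato2004Asterisque, Thm. 12.5, Thm. 12.6, Thm. 17.4 (3), §17.13 (p. 280)] -/
theorem smallImageMuTransfer_MuTransfer_of_kato
    (hfineZ : exists_divisibilityInputs_fineQuotient_zeta)
    (hKato : ∀ (W : WeierstrassCurve ℚ) [W.IsElliptic] [W.IsGloballyMinimal] (p : ℕ) [Fact p.Prime]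
      (κ : ZpExtension ℚ p) (γ : Field.absoluteGaloisGroup ℚ) (N : ℕ) [NeZero N]
      (f : CuspForm (Gamma0 N) 2), kato_divisibility W p (κ := κ) (γ := γ) (f := f))
    (hBCS : burungale_castella_skinner_charIdeal_eq_padicLFunction)
    (hRu : Rubin1991.thm123_charIdeal_eq_padicLFunction_of_cm)
    (hGV : GreenbergVatsal2000.thm14_mainConjecture_transfer_of_torsionIso)
    (h5 : realPeriodRat_eq_unit_mul_plusPeriod)
    (hlev : ∀ (N : ℕ) [NeZero N], IsNewformOf.level_eq_conductorNorm (N := N)) :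
    Summit.BirchSwinnertonDyer.BirchSwinnertonDyer.Theses.SmallImageMuTransfer.MuTransfer :=
  smallImageMuTransfer_MuTransfer_of_facts hfineZ
    Summit.BirchSwinnertonDyer.BirchSwinnertonDyer.Rank1Residual.UniversalNorms.mem_pSmul_of_red_eq_zero_holds hKato hBCS hRu hGV h5 hlev

/-- **`Rank1Residual.KatoMuTransfer` (the head constant of item 19629) modulo F1 and the six published
inputs ONLY** (F2, F3 tree theorems). [cite: Kato2004Asterisque, Thm. 12.5, Thm. 12.6, Thm. 17.4 (3), §17.13 (p. 280)] -/
theorem smallImageMuTransfer_katoMuTransfer_of_kato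
    (hfineZ : exists_divisibilityInputs_fineQuotient_zeta)
    (hKato : ∀ (W : WeierstrassCurve ℚ) [W.IsElliptic] [W.IsGloballyMinimal] (p : ℕ) [Fact p.Prime]
      (κ : ZpExtension ℚ p) (γ : Field.absoluteGaloisGroup ℚ) (N : ℕ) [NeZero N]
      (f : CuspForm (Gamma0 N) 2), kato_divisibility W p (κ := κ) (γ := γ) (f := f))
    (hBCS : burungale_castella_skinner_charIdeal_eq_padicLFunction)
    (hRu : Rubin1991.thm123_charIdeal_eq_padicLFunction_of_cm)
    (hGV : GreenbergVatsal2000.thm14_mainConjecture_transfer_of_torsionIso)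
    (h5 : realPeriodRat_eq_unit_mul_plusPeriod)
    (hlev : ∀ (N : ℕ) [NeZero N], IsNewformOf.level_eq_conductorNorm (N := N)) :
    Summit.BirchSwinnertonDyer.BirchSwinnertonDyer.Rank1Residual.KatoMuTransfer :=
  smallImageMuTransfer_MuTransfer_of_kato hfineZ hKato hBCS hRu hGV h5 hlev

end Summit.BirchSwinnertonDyer.BirchSwinnertonDyer.Theorems
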